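import Summits.Ventures.Crystal3D.Theorems.StickyWulffConstantGenericWallFloorStackLedgerOneSidedDownDirs
import Summits.Ventures.Crystal3D.Theorems.StickyWulffConstantCoaxialWallLawLedgerWithDefs
import HarnessLib

/-!
# Restatement programme, GENERIC cone, leaf G7: the W1-conditional one-sided ledger of grain 2 walking DOWN AT explicit constants

HONEST FRAMING. Venture `Summits/Ventures/Crystal3D` (cell `crystal3d-full`); helper `--supports` the crux `GenericWallFloor`
(stmt-Ventures-19480, line `WallLedgerG`) and lane T's uniform port of the generic cone (cf-p1 DECISION (lxvii)(2), 2026-08-29: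
«restatement programme GO … 19480-p2 = the GENERIC cone»; T-V5 P5 `betaIIIAt_of_coverage`).  Rung credit only (census-free,
standard axioms); F-C1 not moved; E1 (`ExactOnly`) and the StarPairFar consequences stay BY NAME.

The theorem below is `twoSlabAdhesion_stackLedger_oneSidedDown_dirs` (…GenericWallFloorStackLedgerOneSidedDownDirs — the leaf under `twoSlabLedgerAt_oneSidedDown_dirs` → `genericWallFloorAtCharge_oneSidedDown_dirs{{,_of_far}}` (the certificate class `OneSidedFamilyDownAt`)) with its conclusion in the
explicit-constant currency `TwoSlabLedgerWith C 10 q` of `…CoaxialWallLawLedgerWithDefs`: ONE constant `C = (240√2π + 4440·42)/2 + (128 + 16·(9/δ) + 24192) + K`, `K` absolute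
(twice the uniform sample-deficit constant of `affineSampleDeficit_upper_unif`, in absolute value), for ALL pairs and data.  The proof
body is the original verbatim; only the two `affineSampleDeficit_upper` lines are replaced by the uniform bound (recipe (i)–(iii)).
WHAT THIS IS NOT: no new mathematics; not the stub; F-C1 not moved.
-/

noncomputable section

namespace Summit.Ventures.Crystal3D.Theorems

open Summit.Ventures.Crystal3D Finset
open Literature.MathematicalPhysics.StatisticalMechanics (fccStacking barlowStacking IsHaggSeq contactDeficiency)
open scoped InnerProductSpace

open scoped Classical in
/-- **G7 — `twoSlabAdhesion_stackLedger_oneSidedDown_dirs` at explicit constants.**  One absolute `K` such that, for every datum of the original hypotheses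
(verbatim), the pair satisfies `TwoSlabLedgerWith (… + K) 10 (½√2|⟪A₂u₂,e₃⟫|)`. -/
theorem twoSlabAdhesionWith_stackLedger_oneSidedDown_dirs : ∃ K : ℝ, ∀
    {s₀ : EuclideanSpace ℝ (Fin 3)} (hs₀ : s₀ ∈ fccSlots)
    (hcert : ExactOnly 0 (fccSlots.filter fun w => 0 < ⟪w, s₀⟫_ℝ))
    (hDS : ∀ F₁ F₂ : EuclideanSpace ℝ (Fin 3) ≃ₗᵢ[ℝ] EuclideanSpace ℝ (Fin 3), DoubleStarCoaxialAt F₁ F₂)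
    (hCP : CapPairCoaxial)
    (A₁ : EuclideanSpace ℝ (Fin 3) ≃ₗᵢ[ℝ] EuclideanSpace ℝ (Fin 3)) (t₁ : EuclideanSpace ℝ (Fin 3))
    (A₂ : EuclideanSpace ℝ (Fin 3) ≃ₗᵢ[ℝ] EuclideanSpace ℝ (Fin 3)) (t₂ : EuclideanSpace ℝ (Fin 3))
    {z : EuclideanSpace ℝ (Fin 3)} (hz : ‖z‖ = 1)
    {u₂ : EuclideanSpace ℝ (Fin 3)} (hu₂ : u₂ ∈ fccSlots)
    (hsteep₂ : Real.sqrt 2 / 2 ≤ ⟪A₂ u₂, z⟫_ℝ) {δ : ℝ} (hδ : 0 < δ) (hdown : δ ≤ -(A₂ u₂) 2)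
    (M₂ : Set (EuclideanSpace ℝ (Fin 3) ≃ₗᵢ[ℝ] EuclideanSpace ℝ (Fin 3)))
    (hM₂ : ∀ stk : List WalkEntry, StackSound z stk → StackWF z stk → stk.getLast? = some ⟨A₂, u₂, 0⟩ →
      ∀ e ∈ stk, e.frame ∈ M₂)
    (hfar : ∀ F ∈ M₂, F '' fccStacking 1 (Real.sqrt (2 / 3)) ≠ A₁ '' fccStacking 1 (Real.sqrt (2 / 3)))
    (hdirs : ∀ stk : List WalkEntry, StackSound z stk → StackWF z stk → stk.getLast? = some ⟨A₂, u₂, 0⟩ →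
      ∀ e rest, stk = e :: rest → (e.frame e.dir) 2 ≤ 0),
    TwoSlabLedgerWith ((240 * Real.sqrt 2 * Real.pi + 4440 * (4 * 10 + 2)) / 2 + (128 + 16 * (9 / δ) + 24192) + K) 10
      (Real.sqrt 2 * |⟪A₂ u₂, EuclideanSpace.single (2 : Fin 3) (1 : ℝ)⟫_ℝ| / 2) A₁ t₁ A₂ t₂ := by
  obtain ⟨Cu, hCu⟩ := affineSampleDeficit_upper_unif
  refine ⟨|Cu * (1 + 10)| + |Cu * (1 + 10)|, ?_⟩
  intro s₀ hs₀ hcert hDS hCP A₁ t₁ A₂ t₂ z hz u₂ hu₂ hsteep₂ δ hδ hdown M₂ hM₂ hfar hdirs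
  set C₁ : ℝ := Cu * (1 + 10) with hC₁def
  have hC₁ := hCu A₁ t₁ 10 (by norm_num)
  have hC₂ := hCu A₂ t₂ 10 (by norm_num)
  set L : ℝ := 9 / δ with hL; have hL0 : 0 ≤ L := by rw [hL]; positivity
  set Cm : ℝ := 128 + 16 * L + 24192 with hCm; have hCm0 : 0 ≤ Cm := by rw [hCm]; positivity
  intro h hh ρ hρ X P₁ P₂ hX hP₁X hP₂X hcell hP₁ hP₂
  set e₃ : EuclideanSpace ℝ (Fin 3) := EuclideanSpace.single (2 : Fin 3) (1 : ℝ) with he₃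
  have he₃i : ∀ d : EuclideanSpace ℝ (Fin 3), ⟪d, e₃⟫_ℝ = d 2 := fun d => by rw [he₃, EuclideanSpace.inner_single_right]; simp
  set φ₁ : ℝ := Real.sqrt 2 / 4 * ∑ᶠ w ∈ {w ∈ fccStacking 1 (Real.sqrt (2 / 3)) | ‖w‖ = 1},
      |⟪w, A₁.symm (EuclideanSpace.single (2 : Fin 3) (1 : ℝ))⟫_ℝ| with hφ₁
  set φ₂ : ℝ := Real.sqrt 2 / 4 * ∑ᶠ w ∈ {w ∈ fccStacking 1 (Real.sqrt (2 / 3)) | ‖w‖ = 1},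
      |⟪w, A₂.symm (EuclideanSpace.single (2 : Fin 3) (1 : ℝ))⟫_ℝ| with hφ₂
  have hP₂X' : P₂ ⊆ X := hP₂X.trans Finset.sdiff_subset
  obtain ⟨hρ0, hρ1⟩ : (0 : ℝ) ≤ ρ ∧ (1 : ℝ) ≤ ρ := ⟨by linarith, by linarith⟩
  -- fuel `N`, inner disc `ρs`
  set Hz : ℝ := ρ + h + 4 * 10 with hHz; have hHz0 : 0 ≤ Hz := by rw [hHz]; positivity
  set N : ℕ := ⌈6 * Hz + 1⌉₊ with hNdef
  set ρs : ℝ := ρ - 3 - L with hρs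
  set deg : EuclideanSpace ℝ (Fin 3) → ℕ := fun x => (X.filter fun q => dist x q = 1).card with hdeg
  have hdeg12 : ∀ x, deg x ≤ 12 := fun x => card_filter_dist_eq_one_le_twelve X hX x
  set PAY := X.filter fun y => (X.filter fun q => dist y q = 1).card ≠ 12 ∧
    -10 - 2 ≤ y 2 ∧ y 2 ≤ h + 10 + 2 with hPAY
  -- the RIM of the cell: lateral radius `> ρ − 2`
  set RIM := X.filter fun y => (ρ - 2) ^ 2 < y 0 ^ 2 + y 1 ^ 2 with hRIM
  have hRIMcard : ((RIM.card : ℕ) : ℝ) ≤ 48 * (h + 2 * 10 - -(2 * 10) + 2) * (ρ - 1) := by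
    rw [hRIM]; exact card_cellRim_le X hX (-(2 * 10)) (h + 2 * 10) ρ (by linarith) (by linarith) hcell
  -- the weighted interior ledger
  have hled := ledger_ge_faces_add_interior_credits A₁ t₁ A₂ t₂ X P₁ P₂ 10 h ρ le_rfl hh hρ hX hcell hP₁X hP₂X'
    hP₁ hP₂
  rw [← finsum_unit_fcc_symm_eq_sum_slots A₁, ← finsum_unit_fcc_symm_eq_sum_slots A₂, ← hφ₁, ← hφ₂, ← hPAY] at hled
  -- heights for the steering vertical and the fuel
  have hH₂ : ∀ q ∈ X, ⟪q, z⟫_ℝ ≤ Hz := fun q hq => by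
    have h1 := real_inner_le_norm q z
    rw [hz, mul_one] at h1
    exact h1.trans (norm_le_of_mem_cell (by norm_num) hh hρ0 (hcell q hq))
  have hlowz : ∀ q ∈ X, -Hz ≤ ⟪q, z⟫_ℝ := fun q hq => by
    have h1 := real_inner_le_norm (-q) z
    rw [hz, mul_one, norm_neg, inner_neg_left] at h1
    have h2 := norm_le_of_mem_cell (R₀ := 10) (by norm_num) hh hρ0 (hcell q hq)
    linarith
  have hN : (6 : ℝ) * Hz + 1 ≤ (N : ℝ) := by rw [hNdef]; exact Nat.le_ceil _
  have hNh_of : ∀ q ∈ X, 8 * (Hz - ⟪q, z⟫_ℝ) < 3 * (N : ℝ) := fun q hq => by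
    have := hlowz q hq; linarith
  -- fluxes
  set κ₂ : ℝ := Real.sqrt 2 * |⟪A₂ u₂, e₃⟫_ℝ| with hκ₂
  have hsq : 0 ≤ Real.sqrt 2 := Real.sqrt_nonneg 2; have hπ : Real.pi ≤ 4 := Real.pi_le_four; have hπ0 : 0 ≤ Real.pi := Real.pi_pos.le
  have hs2' : Real.sqrt 2 ≤ 2 := by
    rw [show (2 : ℝ) = Real.sqrt (2 ^ 2) by rw [Real.sqrt_sq (by norm_num)]]; exact Real.sqrt_le_sqrt (by norm_num)
  have hκ₂0 : 0 ≤ κ₂ := mul_nonneg hsq (abs_nonneg _)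
  have hκ₂2 : κ₂ ≤ 2 := by
    have := mul_le_mul hs2' (abs_inner_slot_le_one A₂ hu₂) (abs_nonneg _) (by norm_num); linarith
  -- a first bottom entry, different from grain 2's (the count lemma is used with an EMPTY first family)
  have hu₂0 : A₂ u₂ ≠ 0 := fun h0 => by
    have := norm_eq_one_of_mem_fccSlots hu₂; rw [← LinearIsometryEquiv.norm_map A₂, h0, norm_zero] at this
    exact zero_ne_one this
  have hbb : (⟨A₂, u₂, A₂ u₂⟩ : WalkEntry) ≠ ⟨A₂, u₂, 0⟩ := fun hb => hu₂0 (congrArg WalkEntry.nrm hb)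
  -- the main estimate: the payer sum dominates the tops, up to the flux loss and the rim
  have hmain : κ₂ * Real.pi * ρ ^ 2 - Cm * (1 + h) * ρ ≤
      (∑ y ∈ PAY, ((12 : ℝ) - ((X.filter fun q => dist y q = 1).card : ℝ))) := by
    have hPAY0 : 0 ≤ ∑ y ∈ PAY, ((12 : ℝ) - ((X.filter fun q => dist y q = 1).card : ℝ)) :=
      Finset.sum_nonneg fun y _ => by
        have h'' : ((X.filter fun q => dist y q = 1).card : ℝ) ≤ 12 := by exact_mod_cast hdeg12 y
        linarith
    have hhρ : 0 ≤ h * ρ := mul_nonneg hh hρ0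
    by_cases hbig : 11 + L ≤ ρ
    · -- BIG CELL: run the walkers
      have hρs8 : 8 ≤ ρs := by rw [hρs]; linarith
      have hρs0 : 0 ≤ ρs := (by linarith); have hρsρ : ρs ≤ ρ - 1 := by rw [hρs]; linarith only [hL0]
      have hρs2 : ρs ^ 2 ≤ ρ ^ 2 := by nlinarith only [hρs0, hρsρ]
      have hρs3 : ρs ^ 2 ≤ (ρ - 1) ^ 2 := by nlinarith only [hρs0, hρsρ]
      -- the inner sample, tops and end-state map
      set S₂ := P₂.filter fun p => (h + 11) ≤ p 2 ∧ p 2 ≤ (h + 11) + 8 ∧ p 0 ^ 2 + p 1 ^ 2 ≤ ρs ^ 2 with hS₂def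
      set T₂ := S₂.filter fun p => p + A₂ u₂ ∉ S₂ with hT₂def
      set f₂ : EuclideanSpace ℝ (Fin 3) → EuclideanSpace ℝ (Fin 3) × List WalkEntry :=
        fun p => walkRun X z N (p + A₂ u₂, [⟨A₂, u₂, 0⟩]) with hf₂
      have hS₂mem : ∀ p, p ∈ S₂ ↔ (p ∈ P₂ ∧ (h + 11) ≤ p 2 ∧ p 2 ≤ (h + 11) + 8 ∧ p 0 ^ 2 + p 1 ^ 2 ≤ ρs ^ 2) :=
        fun p => by rw [hS₂def, Finset.mem_filter]
      have hS₂ : ∀ p, p ∈ S₂ ↔ (p ∈ (fun q => A₂ q + t₂) '' fccStacking 1 (Real.sqrt (2 / 3)) ∧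
          (h + 11) ≤ p 2 ∧ p 2 ≤ (h + 11) + 8 ∧ p 0 ^ 2 + p 1 ^ 2 ≤ ρs ^ 2) := by
        intro p
        rw [hS₂def, Finset.mem_filter, hP₂]
        constructor
        · rintro ⟨⟨hΛ, -, -, -⟩, h1, h2, h3⟩; exact ⟨hΛ, by linarith only [h1], by linarith only [h2], h3⟩
        · rintro ⟨hΛ, h1, h2, h3⟩
          exact ⟨⟨hΛ, by linarith only [h1, hh], by linarith only [h2], by linarith only [h3, hρs2]⟩, h1, h2, h3⟩
      -- the tops count
      obtain ⟨Ea, Eb, hEa, hEb, hdet, hframe, -⟩ := exists_frame_of_mem_fccSlots hu₂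
      have hT₂ := tops_ge_lineCount A₂ t₂ (h + 11) 8 ρs (by norm_num) hρs8 S₂ hS₂ Ea Eb u₂ hEa hEb
        (norm_eq_one_of_mem_fccSlots hu₂) hdet hframe
      have hT₂' : κ₂ * Real.pi * ρs ^ 2 - 10 * Real.sqrt 2 * Real.pi * ρs ≤ (T₂.card : ℝ) := by rw [hT₂def]; exact hT₂
      have hT₂'' : κ₂ * Real.pi * ρ ^ 2 - (128 + 16 * L) * ρ ≤ (T₂.card : ℝ) :=
        le_trans (flux_loss_inner_disc_room hκ₂0 hκ₂2 hρ0 hL0 (by rw [hρs]) hρs0 hρsρ) hT₂'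
      -- GRAIN 2: fullness of the sample, end data, injectivity
      have hfull₂ : ∀ p ∈ S₂, p ∈ X ∧ ∀ w ∈ fccSlots, p + A₂ w ∈ X := by
        intro p hpS
        obtain ⟨hpΛ, hp1, hp2, hp3⟩ := (hS₂ p).1 hpS
        exact ⟨hP₂X' ((hS₂mem p).1 hpS).1, fun w hw => hP₂X' (inner_sample_full_window A₂ t₂ P₂ (h + 10) (h + 2 * 10) ρ
          hρ1 hP₂ hpΛ (by linarith only [hp1]) (by linarith only [hp2]) (by linarith only [hp3, hρs3]) hw)⟩
      have hend₂ : ∀ t ∈ T₂, (f₂ t).1 ∈ X ∧ deg (f₂ t).1 ≤ 11 ∧ WalkInv X z (f₂ t) ∧ StackWF z (f₂ t).2 ∧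
          (f₂ t).2.getLast? = some ⟨A₂, u₂, 0⟩ ∧ (∃ e rest, (f₂ t).2 = e :: rest ∧ WalkCertified12 X (f₂ t).1 e) ∧
          (∀ e ∈ (f₂ t).2, e.frame ∈ M₂) ∧
          ((f₂ t).1 0 ^ 2 + (f₂ t).1 1 ^ 2 ≤ (ρ - 2) ^ 2 → (f₂ t).1 ∈ PAY) := by
        intro p hp
        have hpS : p ∈ S₂ := by rw [hT₂def] at hp; exact (Finset.mem_filter.1 hp).1
        obtain ⟨hpΛ, hp1, hp2, hp3⟩ := (hS₂ p).1 hpS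
        obtain ⟨hpX, hfull⟩ := hfull₂ p hpS
        have hy0X : p + A₂ u₂ ∈ X := hfull u₂ hu₂
        have hNh : 8 * (Hz - ⟪p + A₂ u₂, z⟫_ℝ) < 3 * (N : ℝ) := hNh_of _ hy0X
        have hI₀ : WalkInv X z (p + A₂ u₂, [⟨A₂, u₂, 0⟩]) := walkInv_start A₂ hpX hfull hu₂ hsteep₂
        obtain ⟨hyX, hydeg, -, -, -, -⟩ := stackWalk_end hX hs₀ hcert hz hH₂ hI₀ hNh
        have hfw' : walkRun X z N (p + A₂ u₂, [⟨A₂, u₂, 0⟩]) = f₂ p := rfl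
        rw [hfw'] at hyX hydeg
        have hvalid := walkRun_valid hX hs₀ hcert hz N hI₀ (stackWF_start z A₂ u₂)
        have hlast₂ : (f₂ p).2.getLast? = some ⟨A₂, u₂, 0⟩ := by
          rw [← hfw', walkRun_getLast? hX hs₀ hcert hz N _ hI₀]; rfl
        have hfrM : ∀ e ∈ (f₂ p).2, e.frame ∈ M₂ := hM₂ (f₂ p).2 hvalid.1.2.1 hvalid.2 hlast₂
        -- the end is not above the start (weak direction ceiling)
        have hdrop : (f₂ p).1 2 ≤ (p + A₂ u₂) 2 :=
          walkRun_height_le_of_dirs hX hs₀ hcert hz A₂ u₂ hdirs hI₀ (stackWF_start z A₂ u₂) rfl N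
        have hy0eq : (p + A₂ u₂) 2 = p 2 + (A₂ u₂) 2 := by simp
        refine ⟨hyX, hydeg, hvalid.1, hvalid.2, hlast₂, ?_, hfrM, fun hlat2 => ?_⟩
        · rw [← hfw']
          exact walkRun_certified12 hX hs₀ hcert hz hI₀ ⟨⟨A₂, u₂, 0⟩, [], rfl, Or.inl ⟨by simpa using hpX,
            fun w hw => by simp only [add_sub_cancel_right]; exact hfull w hw⟩⟩ N
        · -- INNER end: not low (sealing of the bottom plate, `hfar`), not high (monotone height + sealing above)
          have hnotlow := stackWalk_end_not_low_sep hX hs₀ hcert A₁ t₁ P₁ 10 ρ (by linarith only [hρ]) hP₁X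
            (fun q hq => (hcell q hq).1) hP₁ hz hH₂ hI₀ hNh
            (fun e' he' => hfar e'.frame (hfrM e' (by rw [← hfw']; exact he'))) hlat2
          rw [hfw'] at hnotlow
          have hylat : (f₂ p).1 0 ^ 2 + (f₂ p).1 1 ^ 2 ≤ (ρ - 1) ^ 2 := le_trans hlat2 (by nlinarith only [hρ])
          rw [hPAY, Finset.mem_filter]
          refine ⟨hyX, by show deg _ ≠ 12; exact fun h12 => by simp only [hdeg] at h12; omega, ?_, ?_⟩
          · have : (-10 : ℝ) - 2 < (f₂ p).1 2 := hnotlow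
            linarith only [this]
          by_contra hhigh; push Not at hhigh
          exact not_unsaturated_in_slab A₂ t₂ (h + 10) (h + 2 * 10) ρ hρ1 X P₂ hX hP₂X' hP₂ hyX
            (by linarith only [hhigh]) (by linarith only [hdrop, hy0eq, hp2, hdown, hδ]) hylat hydeg
      have hinj₂ : ∀ t ∈ T₂, ∀ t' ∈ T₂, f₂ t = f₂ t' → t = t' := by
        intro t ht t' ht' hft; rw [hT₂def, Finset.mem_filter] at ht ht'
        refine walkRun_start_injective_steer_down hX hs₀ hcert hz A₂ t₂ hu₂ hsteep₂ hδ hdown P₂ (a := h + 10)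
          (b := h + 2 * 10) (r := ρs) (by linarith only [hρ]) (by linarith only [hh]) hP₂X' hP₂
          (fun q hq => (hcell q hq).2.1) hρs0 (by rw [hρs, hL]; ring_nf; linarith) S₂ (Finset.filter_subset _ _)
          (fun p hp => ⟨by linarith only [((hS₂mem p).1 hp).2.1], ((hS₂mem p).1 hp).2.2.2⟩)
          (fun p hp => (hfull₂ p hp).2)
          (sample_interval A₂ t₂ P₂ S₂ hρs0 (by linarith only [hρsρ]) (by linarith only [hh]) (by linarith only [hh])
            hP₂ hS₂mem hu₂)
          ht.1 ht.2 ht'.1 ht'.2 hft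
      -- the END CLASSES: inner payers and rim balls (disjoint)
      set PAYin := PAY.filter fun y => y 0 ^ 2 + y 1 ^ 2 ≤ (ρ - 2) ^ 2 with hPAYin
      have hdisj : Disjoint PAYin RIM := by
        rw [Finset.disjoint_left]; intro y hy hy'
        rw [hPAYin, Finset.mem_filter] at hy; rw [hRIM, Finset.mem_filter] at hy'
        exact absurd hy.2 (not_le.2 hy'.2)
      have hendD : ∀ t ∈ T₂, (f₂ t).1 ∈ PAYin ∪ RIM := by
        intro t ht
        obtain ⟨hyX, -, -, -, -, -, -, hpay⟩ := hend₂ t ht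
        rw [Finset.mem_union]
        by_cases hlat : (f₂ t).1 0 ^ 2 + (f₂ t).1 1 ^ 2 ≤ (ρ - 2) ^ 2
        · exact Or.inl (by rw [hPAYin, Finset.mem_filter]; exact ⟨hpay hlat, hlat⟩)
        · exact Or.inr (by rw [hRIM, Finset.mem_filter]; exact ⟨hyX, not_le.1 hlat⟩)
      -- THE COUNT: per end ball, `deg + #fibre₂ ≤ 12` (the two-family count lemma with an EMPTY first family)
      have hpt : ∀ y ∈ PAYin ∪ RIM, deg y + (T₂.filter fun t => (f₂ t).1 = y).card ≤ 12 := by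
        intro y _
        set fib₂ := T₂.filter fun t => (f₂ t).1 = y with hfib₂
        by_cases hemp : fib₂ = ∅
        · rw [hemp, Finset.card_empty]; have := hdeg12 y; omega
        have hdegy : deg y ≤ 11 := by
          obtain ⟨t, ht⟩ := Finset.nonempty_iff_ne_empty.2 hemp
          obtain ⟨htT, hty⟩ := Finset.mem_filter.1 ht; have := (hend₂ t htT).2.1; rw [hty] at this; exact this
        set ES₂ := fib₂.image f₂ with hES₂
        have hc₂ : ES₂.card = fib₂.card := Finset.card_image_of_injOn fun t ht t' ht' hft =>
          hinj₂ t (Finset.mem_filter.1 ht).1 t' (Finset.mem_filter.1 ht').1 hft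
        have key := card_contacts_add_endStates_le_twelve_sep hX hDS hCP (∅ : Set _) M₂
          (fun F₁ hF₁ _ _ => absurd hF₁ (Set.notMem_empty F₁)) hbb
          (z₁ := e₃) (z₂ := z) hdegy (∅ : Finset _) ES₂ (fun s hs => absurd hs (Finset.notMem_empty s)) (fun s hs => ?_)
        · rw [hc₂, Finset.card_empty, add_zero] at key; exact key
        · obtain ⟨t, ht, rfl⟩ := Finset.mem_image.1 hs
          obtain ⟨htT, hty⟩ := Finset.mem_filter.1 ht
          obtain ⟨-, -, hI, hW, hlast, hC, hfr, -⟩ := hend₂ t htT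
          rw [hty] at hC; exact ⟨hty, hI, hW, hlast, hC, hfr⟩
      -- summing over the end classes
      have hsum₂ : T₂.card = ∑ y ∈ PAYin ∪ RIM, (T₂.filter fun t => (f₂ t).1 = y).card :=
        Finset.card_eq_sum_card_fiberwise fun t ht => hendD t ht
      have hcountD : (T₂.card : ℝ) ≤ ∑ y ∈ PAYin ∪ RIM, ((12 : ℝ) - ((X.filter fun q => dist y q = 1).card : ℝ)) := by
        rw [hsum₂]
        push_cast
        refine Finset.sum_le_sum fun y hy => ?_
        have := hpt y hy
        have h' : (deg y : ℝ) + ((T₂.filter fun t => (f₂ t).1 = y).card : ℝ) ≤ 12 := by exact_mod_cast this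
        simp only [hdeg] at h'
        linarith
      have hsplitD : ∑ y ∈ PAYin ∪ RIM, ((12 : ℝ) - ((X.filter fun q => dist y q = 1).card : ℝ)) ≤
          (∑ y ∈ PAY, ((12 : ℝ) - ((X.filter fun q => dist y q = 1).card : ℝ))) + 12 * (RIM.card : ℝ) := by
        rw [Finset.sum_union hdisj]
        have h1 : ∑ y ∈ PAYin, ((12 : ℝ) - ((X.filter fun q => dist y q = 1).card : ℝ)) ≤
            ∑ y ∈ PAY, ((12 : ℝ) - ((X.filter fun q => dist y q = 1).card : ℝ)) :=
          Finset.sum_le_sum_of_subset_of_nonneg (by rw [hPAYin]; exact Finset.filter_subset _ _) fun y _ _ => by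
            have h'' : ((X.filter fun q => dist y q = 1).card : ℝ) ≤ 12 := by exact_mod_cast hdeg12 y
            linarith
        have h2 : ∑ y ∈ RIM, ((12 : ℝ) - ((X.filter fun q => dist y q = 1).card : ℝ)) ≤ ∑ y ∈ RIM, (12 : ℝ) :=
          Finset.sum_le_sum fun y _ => by
            have h'' : (0 : ℝ) ≤ ((X.filter fun q => dist y q = 1).card : ℝ) := Nat.cast_nonneg _
            linarith
        rw [Finset.sum_const, nsmul_eq_mul] at h2
        linarith
      have hrim' : 12 * (RIM.card : ℝ) ≤ 24192 * (1 + h) * ρ := by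
        have h1 : (RIM.card : ℝ) ≤ 48 * (h + 2 * 10 - -(2 * 10) + 2) * (ρ - 1) := by exact_mod_cast hRIMcard
        nlinarith only [h1, hh, hρ1, hhρ]
      have hflux' : (128 + 16 * L) * ρ ≤ (128 + 16 * L) * ((1 + h) * ρ) :=
        mul_le_mul_of_nonneg_left (by nlinarith only [hh, hρ0]) (by positivity)
      have hCm' : Cm * (1 + h) * ρ = (128 + 16 * L) * ((1 + h) * ρ) + 24192 * (1 + h) * ρ := by rw [hCm]; ring
      linarith only [hcountD, hsplitD, hrim', hT₂'', hflux', hCm']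
    · -- SMALL CELL: the flux is within the error
      push Not at hbig
      have hsmall : κ₂ * Real.pi * ρ ^ 2 ≤ Cm * (1 + h) * ρ := by
        have h1 : κ₂ * Real.pi ≤ 8 := by nlinarith only [hκ₂0, hκ₂2, hπ, hπ0]
        have h2 : κ₂ * Real.pi * ρ ^ 2 ≤ 8 * ρ ^ 2 := mul_le_mul_of_nonneg_right h1 (sq_nonneg ρ)
        have h3 : ρ ^ 2 ≤ ρ * (11 + L) := by rw [sq]; exact mul_le_mul_of_nonneg_left hbig.le hρ0
        have h4 : 8 * (ρ * (11 + L)) ≤ Cm * ρ := by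
          rw [hCm]; nlinarith only [hρ0, hL0]
        have h5 : Cm * ρ ≤ Cm * (1 + h) * ρ := by nlinarith only [hCm0, hh, hρ0, hhρ]
        linarith only [h2, h3, h4, h5]
      linarith only [hsmall, hPAY0]
  -- the two upper slab counts and the two splits
  have hD₁ := hC₁ (-(2 * 10)) (-10) (by ring) ρ hρ P₁ hP₁; have hD₂ := hC₂ (h + 10) (h + 2 * 10) (by ring) ρ hρ P₂ hP₂
  have hsplit₁ := contactDeficiency_sdiff_split hP₁X; have hsplit₂ := contactDeficiency_sdiff_split hP₂X
  have htwo := two_mul_contactDeficiency_eq_sum X; have hhρ : 0 ≤ h * ρ := mul_nonneg hh hρ0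
  -- constants
  have hb : C₁ * ρ ≤ |C₁| * (1 + h) * ρ := by
    have h1 : 0 ≤ (|C₁| - C₁) * ρ := mul_nonneg (by linarith only [le_abs_self C₁]) hρ0
    have h2 : 0 ≤ |C₁| * h * ρ := by positivity
    linarith only [h1, h2]
  have hc' : C₁ * ρ ≤ |C₁| * (1 + h) * ρ := by
    have h1 : 0 ≤ (|C₁| - C₁) * ρ := mul_nonneg (by linarith only [le_abs_self C₁]) hρ0
    have h2 : 0 ≤ |C₁| * h * ρ := by positivity
    linarith only [h1, h2]
  -- assemble
  set SP : ℝ := ∑ y ∈ PAY, ((12 : ℝ) - ((X.filter fun q => dist y q = 1).card : ℝ)) with hSP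
  set C₀ : ℝ := 240 * Real.sqrt 2 * Real.pi + 4440 * (4 * 10 + 2) with hC₀
  have hDX : φ₁ * Real.pi * ρ ^ 2 + φ₂ * Real.pi * ρ ^ 2 + SP / 2 - C₀ * (1 + h) * ρ / 2 ≤ contactDeficiency X := by linarith only [hled, htwo]
  have hcross : ((((P₁ ×ˢ (X \ P₁)).filter fun pq => dist pq.1 pq.2 = 1).card : ℕ) : ℝ) +
      ((((P₂ ×ˢ ((X \ P₁) \ P₂)).filter fun pq => dist pq.1 pq.2 = 1).card : ℕ) : ℝ) =
      contactDeficiency P₁ + contactDeficiency P₂ + contactDeficiency ((X \ P₁) \ P₂) - contactDeficiency X := by linarith only [hsplit₁, hsplit₂]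
  rw [hcross]
  have hSP : κ₂ * Real.pi * ρ ^ 2 / 2 - Cm * (1 + h) * ρ / 2 ≤ SP / 2 := by linarith only [hmain]
  have hC₀0 : 0 ≤ C₀ * (1 + h) * ρ := by positivity
  have hCm1 : 0 ≤ Cm * (1 + h) * ρ := by positivity
  linarith only [hDX, hSP, hD₁, hD₂, hb, hc', hC₀0, hCm1]

end Summit.Ventures.Crystal3D.Theorems

end
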